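import Summits.ResolutionOfSingularities.ResolutionOfSingularities.Theorems.FrobeniusLadderFInjectiveMacaulayficationT11PlusOriginTransport
import HarnessLib

/-!
# I11 (3′): THE STALK-FORM BRIDGE `h0(T₁₁) → h0(T₁₁⁺)` (road-B frame ⟶ specimen door)
# (crux `FrobeniusLadder.FInjectiveMacaulayfication` stmt-ResolutionOfSingularities-15315, chain w45a, road B; res-L1-w45a-plan-1 R12.36; seat res-L1-w45a-stub-2)

[OURS · L1 W4.5a] AI-written; AI review is weaker than expert review. NOT a statement of any manuscript; no named fact.

`t11Plus_h0_of_hypersurface_h0`: hypothesis = the conclusion of the road-B frame `RoadBFrame.originPointFixable_of_hon` (stub-1) VERBATIM at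
`n = 4` with `Gs` for `![f]` — «for every point `b` of `Spec k[x,y,z,w]/(Gs)` whose ideal is the origin ideal, `PFix_p(𝒪_b)`» —, conclusion =
the hypothesis `h0` of `T11SpecimenDoor.fInjectiveMacaulayfication_T11plus_char7` (stub-3, p518699) VERBATIM (same text over
`Spec k[x,y,z,w,Φ]/(Fs)`), for `Fs 0 = Φ − y² − x³`, `Fs 1 = z² + Φ³ + x¹¹ + w⁷`, `Gs 0 = z² + (y²+x³)³ + x¹¹ + w⁷`; any field, any `p` (the door
takes `p := 7`). Proof: `Spec.stalkIso` at the origin of the hypersurface model + `PointFixableTransport.pointFixable_of_ringEquiv` (p518897) +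
`T11PlusOriginTransport.t11Plus_h0_of_localization` (p521228). FINAL ASSEMBLY (stub-1's instance file):
`T11SpecimenDoor.fInjectiveMacaulayfication_T11plus_char7 k Fs hF₀ hF₁ (t11Plus_h0_of_hypersurface_h0 k 7 Fs hF₀ hF₁ ![g] rfl h_frame)`.
No definitions, no named facts. [folklore]
-/

set_option linter.dupNamespace false

noncomputable section

open MvPolynomial AlgebraicGeometry

namespace Summit.ResolutionOfSingularities.ResolutionOfSingularities.Theorems.FInjectiveMacaulayfication.T11PlusOriginTransportStalk

open Summit.ResolutionOfSingularities.ResolutionOfSingularities.Theorems.FInjectiveMacaulayfication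

/-- **`h0(T₁₁)` (stalk form, road-B frame output) ⟹ `h0(T₁₁⁺)` (the specimen door's hypothesis)**, any field `k`, any `p`; the origin
ideal of the hypersurface model is assumed prime (instance binder; `T11HypersurfacePrime` / pool U7 supply it). [folklore] -/
theorem t11Plus_h0_of_hypersurface_h0 (k : Type) [Field k] (p : ℕ) (Fs : Fin 2 → MvPolynomial (Fin 5) k)
    (hF₀ : Fs 0 = X 4 - X 1 ^ 2 - X 0 ^ 3) (hF₁ : Fs 1 = X 2 ^ 2 + X 4 ^ 3 + X 0 ^ 11 + X 3 ^ 7)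
    (Gs : Fin 1 → MvPolynomial (Fin 4) k) (hG : Gs 0 = X 2 ^ 2 + (X 1 ^ 2 + X 0 ^ 3) ^ 3 + X 0 ^ 11 + X 3 ^ 7)
    [hH : (Ideal.span (Set.range fun j : Fin 4 => Ideal.Quotient.mk (Ideal.span (Set.range Gs)) (MvPolynomial.X j))).IsPrime]
    (h : ∀ b : ↥(Spec (.of (MvPolynomial (Fin 4) k ⧸ Ideal.span (Set.range Gs)))),
      b.asIdeal = Ideal.span (Set.range fun j : Fin 4 => Ideal.Quotient.mk (Ideal.span (Set.range Gs)) (MvPolynomial.X j)) →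
      (∃ (nc : ℕ) (c : Fin nc → (Spec (.of (MvPolynomial (Fin 4) k ⧸ Ideal.span (Set.range Gs)))).presheaf.stalk b), Ideal.span (Set.range c) ≠ ⊥ ∧ (Ideal.span (Set.range c)).radical = IsLocalRing.maximalIdeal ((Spec (.of (MvPolynomial (Fin 4) k ⧸ Ideal.span (Set.range Gs)))).presheaf.stalk b) ∧
        ∀ (j : Fin nc) (𝔔 : PrimeSpectrum (Literature.AlgebraicGeometry.Resolution.blowupAlgebra (Ideal.span (Set.range c)) (c j))),
          𝔔.asIdeal.comap (algebraMap ((Spec (.of (MvPolynomial (Fin 4) k ⧸ Ideal.span (Set.range Gs)))).presheaf.stalk b) (Literature.AlgebraicGeometry.Resolution.blowupAlgebra (Ideal.span (Set.range c)) (c j))) = IsLocalRing.maximalIdeal ((Spec (.of (MvPolynomial (Fin 4) k ⧸ Ideal.span (Set.range Gs)))).presheaf.stalk b) →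
          IsDomain (Localization.AtPrime 𝔔.asIdeal) ∧ ∀ d : ℕ, ringKrullDim (Localization.AtPrime 𝔔.asIdeal) = d → ∀ s : Fin d → Localization.AtPrime 𝔔.asIdeal, (Ideal.span (Set.range s)).radical.IsMaximal → RingTheory.Sequence.IsWeaklyRegular (Localization.AtPrime 𝔔.asIdeal) (List.ofFn s) ∧ ∀ y : Localization.AtPrime 𝔔.asIdeal, (∃ e : ℕ, y ^ p ^ e ∈ Ideal.span ((fun z : Localization.AtPrime 𝔔.asIdeal => z ^ p ^ e) '' (Ideal.span (Set.range s) : Set (Localization.AtPrime 𝔔.asIdeal)))) → y ∈ Ideal.span (Set.range s))) :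
    ∀ b : ↥(Spec (.of (MvPolynomial (Fin 5) k ⧸ Ideal.span (Set.range Fs)))),
      b.asIdeal = Ideal.span (Set.range fun j : Fin 5 => Ideal.Quotient.mk (Ideal.span (Set.range Fs)) (MvPolynomial.X j)) →
    (∃ (nc : ℕ) (c : Fin nc → (Spec (.of (MvPolynomial (Fin 5) k ⧸ Ideal.span (Set.range Fs)))).presheaf.stalk b), Ideal.span (Set.range c) ≠ ⊥ ∧ (Ideal.span (Set.range c)).radical = IsLocalRing.maximalIdeal ((Spec (.of (MvPolynomial (Fin 5) k ⧸ Ideal.span (Set.range Fs)))).presheaf.stalk b) ∧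
        ∀ (j : Fin nc) (𝔔 : PrimeSpectrum (Literature.AlgebraicGeometry.Resolution.blowupAlgebra (Ideal.span (Set.range c)) (c j))),
          𝔔.asIdeal.comap (algebraMap ((Spec (.of (MvPolynomial (Fin 5) k ⧸ Ideal.span (Set.range Fs)))).presheaf.stalk b) (Literature.AlgebraicGeometry.Resolution.blowupAlgebra (Ideal.span (Set.range c)) (c j))) = IsLocalRing.maximalIdeal ((Spec (.of (MvPolynomial (Fin 5) k ⧸ Ideal.span (Set.range Fs)))).presheaf.stalk b) →
          IsDomain (Localization.AtPrime 𝔔.asIdeal) ∧ ∀ d : ℕ, ringKrullDim (Localization.AtPrime 𝔔.asIdeal) = d → ∀ s : Fin d → Localization.AtPrime 𝔔.asIdeal, (Ideal.span (Set.range s)).radical.IsMaximal → RingTheory.Sequence.IsWeaklyRegular (Localization.AtPrime 𝔔.asIdeal) (List.ofFn s) ∧ ∀ y : Localization.AtPrime 𝔔.asIdeal, (∃ e : ℕ, y ^ p ^ e ∈ Ideal.span ((fun z : Localization.AtPrime 𝔔.asIdeal => z ^ p ^ e) '' (Ideal.span (Set.range s) : Set (Localization.AtPrime 𝔔.asIdeal))))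 → y ∈ Ideal.span (Set.range s)) := by
  -- the origin `b_H` of the hypersurface model and `PFix(𝒪_{b_H})`
  let bH : ↥(Spec (.of (MvPolynomial (Fin 4) k ⧸ Ideal.span (Set.range Gs)))) :=
    ⟨Ideal.span (Set.range fun j : Fin 4 => Ideal.Quotient.mk (Ideal.span (Set.range Gs)) (MvPolynomial.X j)), hH⟩
  have hbH := h bH rfl
  -- move it to the localisation `k[X]/(Gs)_𝔪`
  have hPF := PointFixableTransport.pointFixable_of_ringEquiv p
    (O := ↥((Spec (.of (MvPolynomial (Fin 4) k ⧸ Ideal.span (Set.range Gs)))).presheaf.stalk bH))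
    (O' := Localization.AtPrime (Ideal.span (Set.range fun j : Fin 4 => Ideal.Quotient.mk (Ideal.span (Set.range Gs)) (MvPolynomial.X j))))
    (Spec.stalkIso (.of (MvPolynomial (Fin 4) k ⧸ Ideal.span (Set.range Gs))) bH).commRingCatIsoToRingEquiv hbH
  -- and conclude with the localisation-form bridge
  exact T11PlusOriginTransport.t11Plus_h0_of_localization k p Fs hF₀ hF₁ Gs hG hPF

end Summit.ResolutionOfSingularities.ResolutionOfSingularities.Theorems.FInjectiveMacaulayfication.T11PlusOriginTransportStalk

end
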